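import Summits.QuantumFields.YangMills.Theorems.FlatTubeReductionCoreDefectWindowMoments
import Summits.QuantumFields.YangMills.Theorems.FlatTubeReductionCoreDefectMomentSq
import Summits.QuantumFields.YangMills.Theorems.LuscherReductionTwistedTraceScalingBODefectCoreRecord
import Summits.QuantumFields.YangMills.Theorems.LuscherReductionTwistedTraceScalingColourAverage
import Summits.QuantumFields.YangMills.Theorems.FlatTubeReductionCentralColourRemoval
import HarnessLib

/-!
# The integrated `(C4)`-core `L²` estimate with orbit-distance moment data

Support file for the crux `NearFlatRatioLaw` (line `ratepack_v2`, stub `stub_hODpot_A`, `(C2)`-moments route, step (R1) of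
`Cruxes/NearFlatRatioLaw/Lines/ratepack-v7-moments-g18.md`): `…CoreDefectWindowMoments.colour_defect_sq_slow_le_orbit_moments` is the
pointwise hypothesis `hdef` of the moment twin `…CoreDefectMomentSq.defect_core_sq_integral_le_moment` of the (C4)-core `L²` estimate,
with `Φ(u', v') = (∫φ²ρ̄)(u')·(40(1+η_c)((∫g₀ρ̄)𝒴₀ + (∫g₁ρ̄)(𝒴₁+𝒴₂) + 9c₂²(∫ρ̄)(𝒴₃+𝒴₄)) + 2η_c² c_q a₀' e^{-q(x')} ∫ρ̄(u'))`,
`K(U) = Z⁻¹∫φ(w) I(U; w) dw`, slow amplitude `∫φρ̄(u', ·)` (majorant `∫|φ|ρ̄`), output window `{orbitDist ≤ d_O}`, fibre amplitude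
`c_q a₀' e^{-q}`; this file checks the joint measurability / boundedness of `Φ` and composes the two
(`defect_core_sq_integral_le_orbit_moments`).  Left for `stub_hODpot_A`: the slow factors `∫_{W_out}(∫φ²ρ̄)(∫g_mρ̄)` (the `orbitDist²φ²`
potential) and the fibre factors `∫dπ 𝟙_in e^{-q} e^{-‖P_Γ·‖²/δg²} 𝒴_m` (reference moments).
-/

noncomputable section

open MeasureTheory Filter Topology Real
open scoped BigOperators
open Literature.MathematicalPhysics.QuantumFieldTheory
open Literature.MathematicalPhysics.QuantumLattice

namespace Summit.QuantumFields.YangMills.Theorems.FemtoTransferGap.TwoLattice.ConstTube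

open Summit.QuantumFields.YangMills.Theorems.FemtoTransferGap
open Summit.QuantumFields.YangMills.Theorems.FemtoTransferGap.TwoLattice
open Summit.QuantumFields.YangMills.Theorems.FemtoTransferGap.TwoLattice.Avg
open Summit.QuantumFields.YangMills.Theorems.FemtoTransferGap.TwoLattice.Stiff
open Summit.QuantumFields.YangMills.Theorems.FemtoTransferGap.TwoLattice.GnChart

variable {L : ℕ} [NeZero L]

/-! ## §1 Slow smearing of bounded functions -/

/-- `∫ h(w) ρ̄(u', w) dw ≤ C_h · (M/K₁(1,1))` for `0 ≤ h ≤ C_h` and the kernel bound `K ≤ M`. [folklore] -/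
theorem integral_mul_avgRatio_le {B : ℝ} {M : ℝ} (hM : ∀ U V : GaugeConfig 3 1 SU2, transferKernel su2Rep B U V ≤ M)
    {h : GaugeConfig 3 1 SU2 → ℝ} (h0 : ∀ w, 0 ≤ h w) {Ch : ℝ} (hb : ∀ w, h w ≤ Ch) (u' : GaugeConfig 3 1 SU2) :
    ∫ w, h w * (avgKernel B u' w / transferKernel su2Rep B (1 : GaugeConfig 3 1 SU2) 1) ∂configMeasure SU2 1 ≤
      Ch * (M / transferKernel su2Rep B (1 : GaugeConfig 3 1 SU2) 1) := by
  have hK1 := transferKernel_pos su2Rep B (1 : GaugeConfig 3 1 SU2) 1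
  have hρ : ∀ w, 0 ≤ avgKernel B u' w / transferKernel su2Rep B (1 : GaugeConfig 3 1 SU2) 1 ∧
      avgKernel B u' w / transferKernel su2Rep B (1 : GaugeConfig 3 1 SU2) 1 ≤ M / transferKernel su2Rep B (1 : GaugeConfig 3 1 SU2) 1 := fun w =>
    ⟨div_nonneg (avgKernel_pos B u' w).le hK1.le, div_le_div_of_nonneg_right (avgKernel_le B hM u' w) hK1.le⟩
  have hCh : 0 ≤ Ch := (h0 1).trans (hb 1)
  calc ∫ w, h w * (avgKernel B u' w / transferKernel su2Rep B (1 : GaugeConfig 3 1 SU2) 1) ∂configMeasure SU2 1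
      ≤ ∫ _w, Ch * (M / transferKernel su2Rep B (1 : GaugeConfig 3 1 SU2) 1) ∂configMeasure SU2 1 :=
        integral_mono_of_nonneg (ae_of_all _ fun w => mul_nonneg (h0 w) (hρ w).1) (integrable_const _)
          (ae_of_all _ fun w => mul_le_mul (hb w) (hρ w).2 (hρ w).1 hCh)
    _ = Ch * (M / transferKernel su2Rep B (1 : GaugeConfig 3 1 SU2) 1) := by rw [integral_const, smul_eq_mul, probReal_univ, one_mul]

/-- Joint measurability of a slow smearing `(y ↦ ∫ H(y, w) ρ̄(π y, w) dw)` for jointly measurable `H` and measurable `π`. [folklore] -/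
theorem measurable_integral_mul_avgRatio (B : ℝ) {Y : Type*} [MeasurableSpace Y] {πs : Y → GaugeConfig 3 1 SU2} (hπ : Measurable πs)
    {H : Y × GaugeConfig 3 1 SU2 → ℝ} (hH : Measurable H) :
    Measurable fun y : Y => ∫ w, H (y, w) * (avgKernel B (πs y) w / transferKernel su2Rep B (1 : GaugeConfig 3 1 SU2) 1) ∂configMeasure SU2 1 := by
  haveI : SecondCountableTopology SU2 := secondCountableTopology_su2
  have hK : Measurable fun z : Y × GaugeConfig 3 1 SU2 => avgKernel B (πs z.1) z.2 / transferKernel su2Rep B (1 : GaugeConfig 3 1 SU2) 1 := by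
    have h := (measurable_avgKernel (L := 1) B).comp ((hπ.comp measurable_fst).prodMk measurable_snd)
    simpa only [Function.comp_def] using h.div_const _
  exact ((hH.mul hK).stronglyMeasurable.integral_prod_right' (ν := configMeasure SU2 1)).measurable

/-- Joint measurability of a colour-averaged central transfer in the fibre point: `v ↦ ∫ dc T[Ω,W](c⁻¹ oT(1,v) c; 1)`. [folklore] -/
theorem measurable_colour_central_transfer (β : ℝ) {Ω : LinkSpace L → ℝ} (hΩ : Measurable Ω) {W : (Site 3 L → SU2) → ℝ} (hW : Measurable W) :
    Measurable fun v : Edge 3 L → Fin 3 → ℝ => ∫ c, fpFibreTransfer L β Ω W (gaugeTransform (fun _ : Site 3 L => c⁻¹) (orthoTube L 1 v)) 1 ∂haarProbability SU2 := by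
  haveI : SecondCountableTopology SU2 := secondCountableTopology_su2
  have h1 : Measurable fun z : (Edge 3 L → Fin 3 → ℝ) × SU2 => gaugeTransform (fun _ : Site 3 L => z.2⁻¹) (orthoTube L 1 z.1) := by
    have ha : Measurable fun z : (Edge 3 L → Fin 3 → ℝ) × SU2 => (orthoTube L 1 z.1, z.2⁻¹) :=
      ((measurable_orthoTube_right (L := L) 1).comp measurable_fst).prodMk measurable_snd.inv
    have h := (measurable_constGaugeAction (L := L)).comp ha
    simpa only [Function.comp_def] using h
  have h2 : Measurable fun z : (Edge 3 L → Fin 3 → ℝ) × SU2 => fpFibreTransfer L β Ω W (gaugeTransform (fun _ : Site 3 L => z.2⁻¹) (orthoTube L 1 z.1)) 1 := by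
    have h := (measurable_fpFibreTransfer_out (L := L) β hΩ hW 1).comp h1
    simpa only [Function.comp_def] using h
  exact (h2.stronglyMeasurable.integral_prod_right' (ν := haarProbability SU2)).measurable

/-- Pure-real rescaling of the windowed defect bound into the `hdef` shape of `defect_core_sq_integral_le_moment`. [folklore] -/
theorem sq_core_rescale {Zi I c a e Ps A η X R : ℝ}
    (h : (I - c * (a * e) * Ps) ^ 2 ≤ A * (40 * (1 + η) * (c * (a * e)) * X + 2 * η ^ 2 * (c * (a * e)) ^ 2 * R)) :
    (Zi * I - Zi * (c * a * e) * Ps) ^ 2 ≤ Zi ^ 2 * (c * a * e) * (A * (40 * (1 + η) * X + 2 * η ^ 2 * (c * (a * e)) * R)) := by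
  have h1 : (Zi * I - Zi * (c * a * e) * Ps) ^ 2 = Zi ^ 2 * (I - c * (a * e) * Ps) ^ 2 := by ring
  have h2 : Zi ^ 2 * (c * a * e) * (A * (40 * (1 + η) * X + 2 * η ^ 2 * (c * (a * e)) * R)) =
      Zi ^ 2 * (A * (40 * (1 + η) * (c * (a * e)) * X + 2 * η ^ 2 * (c * (a * e)) ^ 2 * R)) := by ring
  rw [h1, h2]; exact mul_le_mul_of_nonneg_left h (sq_nonneg Zi)

/-! ## §2 The integrated estimate -/

set_option maxHeartbeats 1600000 in
-- a single instantiation of `defect_core_sq_integral_le_moment` whose data `K, P, Pa, Φ` are kilobyte-sized lambdas.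
/-- ★★★ **THE INTEGRATED (C4)-CORE `L²` ESTIMATE WITH ORBIT-DISTANCE MOMENT DATA** (see the module docstring): the moment twin of
`…BODefectCoreSq.defect_core_sq_integral_le` composed with the windowed Cauchy–Schwarz core defect — the tube `L²` norm of the core
defect of `K = Z⁻¹∫φ I` against `φ ⊗ Ω` on `{‖x'‖ ≤ R_in, orbitDist(ū) ≤ d_O}` is bounded by
`2Z⁻²(c_q a₀')/(N̄(1−κ)) · ∫dπ 𝟙_in e^{-q} e^{-‖P_Γ‖²/δg²} (∫_{orbitDist ≤ d_O} Φ) + 2(Z⁻¹ c_q a₀' κ)²/(N̄(1−κ)) · (∫dπ 𝟙_in e^{-2q} e^{-‖P_Γ‖²/δg²}) · ∫(∫|φ|ρ̄)²`.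
[cite: Luscher1983, §3] [cite: SjostrandZworski2007, §2] -/
theorem defect_core_sq_integral_le_orbit_moments {β : ℝ} (hβ1 : 1 ≤ β) {F : Set (GaugeConfig 3 L SU2)} (hF : MeasurableSet F) {χ : GaugeConfig 3 L SU2 → ℝ}
    (hχ : ∀ U, χ U = F.indicator (fun _ => (1 : ℝ)) U * Real.exp (-(gaugeCoordSq L U / powScale 1 β ^ 2)))
    {Nbar κ : ℝ} (hNκ : 0 < Nbar * (1 - κ)) (hκ : 0 ≤ κ)
    (hPχ : ∀ U ∈ F, Nbar * (1 - κ) ≤ gaugeAvg χ U ∧ gaugeAvg χ U ≤ Nbar * (1 + κ))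
    {q : ℝ → LinkSpace L → ℝ} (hqm : ∀ β', Measurable (q β')) (hq0 : ∀ x, 0 ≤ q β x) (hqinv : ∀ (g : SU2) (x : LinkSpace L), q β (adL L g x) = q β x) (r : ℝ → ℝ)
    {Ω : LinkSpace L → ℝ} (hΩm : Measurable Ω) {CΩ : ℝ} (hCΩ : ∀ x, |Ω x| ≤ CΩ) (hΩ0 : ∀ x, 0 ≤ Ω x)
    {W : (Site 3 L → SU2) → ℝ} (hW : Measurable W) {CW : ℝ} (hCW : ∀ g, |W g| ≤ CW) (hW0 : ∀ g, 0 ≤ W g)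
    {dO dI T Tc R Rin Γ c₂ : ℝ} (hdO : dO ≤ 1 / 2) (hdI : 0 ≤ dI) (hd1 : dO + dI ≤ 1)
    (hσ : 8 * (Fintype.card (Plaquette 3 1) : ℝ) * (L : ℝ) ^ 3 * (dO ^ 2 + dI ^ 2) < 2) (hRinT : Rin ≤ Tc) (hRin : Rin ≤ r β) (hΓ : 0 ≤ Γ)
    (hΩt : ∀ v : Edge 3 L → Fin 3 → ℝ, Ω (linkEmbed L v) ≠ 0 → v ∈ capBalancedSet L ∧ ‖linkEmbed L v‖ ≤ R)
    (hWc : ∀ g : Site 3 L → SU2, W g ≠ 0 → (∀ x, ‖su2Quat (g x) - 1‖ ≤ T) ∧ ‖∑ x, vecPart (g x)‖ ≤ Γ)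
    {cq a₀' ηc Zi : ℝ} (hcq : 0 ≤ cq) (ha₀' : 0 ≤ a₀') (hηc : 0 ≤ ηc) (hZi : 0 ≤ Zi)
    (hC1 : ∀ v'' : Edge 3 L → Fin 3 → ℝ, v'' ∈ capBalancedSet L → (∀ (e : Edge 3 L) (a : Fin 3), |v'' e a| ≤ Tc) → ‖linkEmbed L v''‖ ≤ Rin →
      |fpFibreTransfer L β Ω W (orthoTube L 1 v'') 1 - cq * (a₀' * Real.exp (-(q β (linkEmbed L v''))))| ≤ ηc * (cq * (a₀' * Real.exp (-(q β (linkEmbed L v''))))))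
    (hS900 : Rin ^ 2 + R ^ 2 + (Fintype.card (Site 3 L) : ℝ) * T ^ 2 ≤ 1 / 900)
    (hc₂ : 300000000 * ((Fintype.card (Edge 3 L) : ℝ) + (Fintype.card (Plaquette 3 L × Fin 3) : ℝ) + (Fintype.card (Plaquette 3 L) : ℝ)) * (β + β * Real.sqrt β / 2) ≤ c₂)
    (hH1 : 216 * β * (dO + dI) * dO * Γ +
        300000000 * ((Fintype.card (Edge 3 L) : ℝ) + (Fintype.card (Plaquette 3 L × Fin 3) : ℝ) + (Fintype.card (Plaquette 3 L) : ℝ)) *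
            (β * ((4 + Real.sqrt (8 * (Fintype.card (Plaquette 3 1) : ℝ) * (L : ℝ) ^ 3)) * (dO + dI)) + Real.sqrt β / 2) *
          (Rin ^ 2 + R ^ 2 + (Fintype.card (Site 3 L) : ℝ) * T ^ 2) +
        c₂ * (Rin ^ 2 + R ^ 2 + (Fintype.card (Site 3 L) : ℝ) * T ^ 2) ^ 2 ≤ 1)
    {φ : GaugeConfig 3 1 SU2 → ℝ} (hφm : Measurable φ) {Cφ : ℝ} (hφb : ∀ u, |φ u| ≤ Cφ) (hφs : ∀ u, φ u ≠ 0 → orbitDist u ≤ dI) :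
    ∫ U, {U : GaugeConfig 3 L SU2 | U ∈ orthoTubeSet L ∧ χ U ≠ 0 ∧ ‖relLinkVec L U‖ ≤ Rin ∧ slowMean L U ∈ {u : GaugeConfig 3 1 SU2 | orbitDist u ≤ dO}}.indicator (fun _ => (1 : ℝ)) U *
        (((Zi * ∫ w, φ w * (∫ c, fpFibreTransfer L β Ω W (gaugeTransform (fun _ : Site 3 L => c⁻¹) U) w ∂haarProbability SU2) ∂configMeasure SU2 1) / softWeight χ U -
            boFun L (fun u' => Zi * (cq * a₀') / Nbar * (∫ w, φ w * (avgKernel ((L : ℝ) ^ 3 * β) u' w / transferKernel su2Rep ((L : ℝ) ^ 3 * β) (1 : GaugeConfig 3 1 SU2) 1) ∂configMeasure SU2 1))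
              (fun x : LinkSpace L => {x : LinkSpace L | linkCurry x ∈ capBalancedSet L}.indicator (fun _ => (1 : ℝ)) x * frozenProfile L q r β x) U) ^ 2 *
          softWeight χ U) ∂configMeasure SU2 L ≤
      2 * (Zi ^ 2 * (cq * a₀')) / (Nbar * (1 - κ)) *
          ∫ v, {v : Edge 3 L → Fin 3 → ℝ | ‖linkEmbed L v‖ ≤ Rin}.indicator (fun _ => (1 : ℝ)) v *
              (Real.exp (-(q β (linkEmbed L v))) * Real.exp (-(‖(gaugeModes L).starProjection (linkEmbed L v)‖ ^ 2 / powScale 1 β ^ 2))) *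
            ∫ u, {u : GaugeConfig 3 1 SU2 | orbitDist u ≤ dO}.indicator (fun _ => (1 : ℝ)) u *
              ((∫ w, φ w ^ 2 * (avgKernel ((L : ℝ) ^ 3 * β) u w / transferKernel su2Rep ((L : ℝ) ^ 3 * β) (1 : GaugeConfig 3 1 SU2) 1) ∂configMeasure SU2 1) *
              (40 * (1 + ηc) *
                  ((∫ w, (216 * β * (orbitDist u + orbitDist w) * orbitDist u * Γ +
                    300000000 * ((Fintype.card (Edge 3 L) : ℝ) + (Fintype.card (Plaquette 3 L × Fin 3) : ℝ) + (Fintype.card (Plaquette 3 L) : ℝ)) *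
                        (β * ((4 + Real.sqrt (8 * (Fintype.card (Plaquette 3 1) : ℝ) * (L : ℝ) ^ 3)) * (orbitDist u + orbitDist w)) + Real.sqrt β / 2) * min (‖linkEmbed L v‖ ^ 2) (Rin ^ 2) +
                    3 * c₂ * (min (‖linkEmbed L v‖ ^ 2) (Rin ^ 2)) ^ 2) ^ 2 * (avgKernel ((L : ℝ) ^ 3 * β) u w / transferKernel su2Rep ((L : ℝ) ^ 3 * β) (1 : GaugeConfig 3 1 SU2) 1) ∂configMeasure SU2 1) *
                    (∫ c, fpFibreTransfer L β Ω W (gaugeTransform (fun _ : Site 3 L => c⁻¹) (orthoTube L 1 v)) 1 ∂haarProbability SU2) +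
                  (∫ w, (300000000 * ((Fintype.card (Edge 3 L) : ℝ) + (Fintype.card (Plaquette 3 L × Fin 3) : ℝ) + (Fintype.card (Plaquette 3 L) : ℝ)) *
                        (β * ((4 + Real.sqrt (8 * (Fintype.card (Plaquette 3 1) : ℝ) * (L : ℝ) ^ 3)) * (orbitDist u + orbitDist w)) + Real.sqrt β / 2)) ^ 2 * (avgKernel ((L : ℝ) ^ 3 * β) u w / transferKernel su2Rep ((L : ℝ) ^ 3 * β) (1 : GaugeConfig 3 1 SU2) 1) ∂configMeasure SU2 1) *
                    ((∫ c, fpFibreTransfer L β (fun x => Ω x * (‖x‖ ^ 2) ^ 2) W (gaugeTransform (fun _ : Site 3 L => c⁻¹) (orthoTube L 1 v)) 1 ∂haarProbability SU2) + (∫ c, fpFibreTransfer L β Ω (fun g => W g * (∑ x, ‖su2Quat (g x) - 1‖ ^ 2) ^ 2) (gaugeTransform (fun _ : Site 3 L => c⁻¹) (orthoTube L 1 v)) 1 ∂haarProbability SU2)) +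
                  9 * c₂ ^ 2 * (∫ w, (avgKernel ((L : ℝ) ^ 3 * β) u w / transferKernel su2Rep ((L : ℝ) ^ 3 * β) (1 : GaugeConfig 3 1 SU2) 1) ∂configMeasure SU2 1) *
                    ((∫ c, fpFibreTransfer L β (fun x => Ω x * (‖x‖ ^ 2) ^ 4) W (gaugeTransform (fun _ : Site 3 L => c⁻¹) (orthoTube L 1 v)) 1 ∂haarProbability SU2) + (∫ c, fpFibreTransfer L β Ω (fun g => W g * (∑ x, ‖su2Quat (g x) - 1‖ ^ 2) ^ 4) (gaugeTransform (fun _ : Site 3 L => c⁻¹) (orthoTube L 1 v)) 1 ∂haarProbability SU2))) +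
                2 * ηc ^ 2 * (cq * (a₀' * Real.exp (-(q β (linkEmbed L v))))) * ∫ w, (avgKernel ((L : ℝ) ^ 3 * β) u w / transferKernel su2Rep ((L : ℝ) ^ 3 * β) (1 : GaugeConfig 3 1 SU2) 1) ∂configMeasure SU2 1)) ∂configMeasure SU2 1 ∂orthoTransverse L +
        2 * (Zi * (cq * a₀') * κ) ^ 2 / (Nbar * (1 - κ)) *
          (∫ v, {v : Edge 3 L → Fin 3 → ℝ | ‖linkEmbed L v‖ ≤ Rin}.indicator (fun _ => (1 : ℝ)) v *
              (Real.exp (-(q β (linkEmbed L v))) ^ 2 * Real.exp (-(‖(gaugeModes L).starProjection (linkEmbed L v)‖ ^ 2 / powScale 1 β ^ 2))) ∂orthoTransverse L) *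
          ∫ u, (∫ w, |φ w| * (avgKernel ((L : ℝ) ^ 3 * β) u w / transferKernel su2Rep ((L : ℝ) ^ 3 * β) (1 : GaugeConfig 3 1 SU2) 1) ∂configMeasure SU2 1) ^ 2 ∂configMeasure SU2 1 := by
  haveI : SecondCountableTopology SU2 := secondCountableTopology_su2
  -- constants and the slow kernel
  obtain ⟨B, hB⟩ : ∃ B : ℝ, B = (L : ℝ) ^ 3 * β := ⟨_, rfl⟩
  obtain ⟨K1, hK1⟩ : ∃ K1 : ℝ, K1 = transferKernel su2Rep B (1 : GaugeConfig 3 1 SU2) 1 := ⟨_, rfl⟩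
  have hK1p : 0 < K1 := by rw [hK1]; exact transferKernel_pos su2Rep _ _ _
  obtain ⟨M, hM⟩ := exists_transferKernel_le su2Rep continuous_su2Rep B (L := 1)
  have hMK : 0 ≤ M / K1 := div_nonneg ((transferKernel_pos su2Rep B (1 : GaugeConfig 3 1 SU2) 1).le.trans (hM 1 1)) hK1p.le
  have hρ0 : ∀ u w : GaugeConfig 3 1 SU2, 0 ≤ avgKernel B u w / K1 := fun u w => div_nonneg (avgKernel_pos B u w).le hK1p.le
  have hβ : (0 : ℝ) ≤ β := by linarith
  obtain ⟨KL, hKL⟩ : ∃ KL : ℝ, KL = 300000000 * ((Fintype.card (Edge 3 L) : ℝ) + (Fintype.card (Plaquette 3 L × Fin 3) : ℝ) + (Fintype.card (Plaquette 3 L) : ℝ)) := ⟨_, rfl⟩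
  obtain ⟨AL, hAL⟩ : ∃ AL : ℝ, AL = (4 + Real.sqrt (8 * (Fintype.card (Plaquette 3 1) : ℝ) * (L : ℝ) ^ 3)) := ⟨_, rfl⟩
  obtain ⟨hKL0, hAL0⟩ : 0 ≤ KL ∧ 0 ≤ AL := ⟨by rw [hKL]; positivity, by rw [hAL]; positivity⟩
  have hc₂0 : 0 ≤ c₂ := le_trans (mul_nonneg (hKL ▸ hKL0) (add_nonneg hβ (div_nonneg (mul_nonneg hβ (Real.sqrt_nonneg _)) two_pos.le))) hc₂
  have hod0 : ∀ u : GaugeConfig 3 1 SU2, 0 ≤ orbitDist u ∧ orbitDist u ≤ 4 * (Fintype.card (Edge 3 1) : ℝ) := fun u => ⟨orbitDist_nonneg u, orbitDist_le_four_card u⟩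
  have hE0 : (0 : ℝ) ≤ 4 * (Fintype.card (Edge 3 1) : ℝ) := by positivity
  -- the pieces of `Φ`
  obtain ⟨Af, hAf⟩ : ∃ Af : GaugeConfig 3 1 SU2 → ℝ, Af = fun u => ∫ w, φ w ^ 2 * (avgKernel B u w / K1) ∂configMeasure SU2 1 := ⟨_, rfl⟩
  obtain ⟨Rf, hRf⟩ : ∃ Rf : GaugeConfig 3 1 SU2 → ℝ, Rf = fun u => ∫ w, avgKernel B u w / K1 ∂configMeasure SU2 1 := ⟨_, rfl⟩
  obtain ⟨c₀f, hc₀f⟩ : ∃ c₀f : GaugeConfig 3 1 SU2 → GaugeConfig 3 1 SU2 → ℝ, c₀f = fun u w => 216 * β * (orbitDist u + orbitDist w) * orbitDist u * Γ := ⟨_, rfl⟩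
  obtain ⟨c₁f, hc₁f⟩ : ∃ c₁f : GaugeConfig 3 1 SU2 → GaugeConfig 3 1 SU2 → ℝ, c₁f = fun u w => KL * (β * (AL * (orbitDist u + orbitDist w)) + Real.sqrt β / 2) := ⟨_, rfl⟩
  obtain ⟨G₁f, hG₁f⟩ : ∃ G₁f : GaugeConfig 3 1 SU2 → ℝ, G₁f = fun u => ∫ w, c₁f u w ^ 2 * (avgKernel B u w / K1) ∂configMeasure SU2 1 := ⟨_, rfl⟩
  obtain ⟨G₀f, hG₀f⟩ : ∃ G₀f : GaugeConfig 3 1 SU2 → (Edge 3 L → Fin 3 → ℝ) → ℝ, G₀f = fun u v =>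
      ∫ w, (c₀f u w + c₁f u w * min (‖linkEmbed L v‖ ^ 2) (Rin ^ 2) + 3 * c₂ * (min (‖linkEmbed L v‖ ^ 2) (Rin ^ 2)) ^ 2) ^ 2 * (avgKernel B u w / K1) ∂configMeasure SU2 1 := ⟨_, rfl⟩
  obtain ⟨Y₀, hY₀⟩ : ∃ Y₀ : (Edge 3 L → Fin 3 → ℝ) → ℝ, Y₀ = fun v => ∫ c, fpFibreTransfer L β Ω W (gaugeTransform (fun _ : Site 3 L => c⁻¹) (orthoTube L 1 v)) 1 ∂haarProbability SU2 := ⟨_, rfl⟩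
  obtain ⟨Y₁, hY₁⟩ : ∃ Y₁ : (Edge 3 L → Fin 3 → ℝ) → ℝ, Y₁ = fun v => ∫ c, fpFibreTransfer L β (fun x => Ω x * (‖x‖ ^ 2) ^ 2) W (gaugeTransform (fun _ : Site 3 L => c⁻¹) (orthoTube L 1 v)) 1 ∂haarProbability SU2 :=
    ⟨_, rfl⟩
  obtain ⟨Y₂, hY₂⟩ : ∃ Y₂ : (Edge 3 L → Fin 3 → ℝ) → ℝ, Y₂ = fun v => ∫ c, fpFibreTransfer L β Ω (fun g => W g * (∑ x, ‖su2Quat (g x) - 1‖ ^ 2) ^ 2) (gaugeTransform (fun _ : Site 3 L => c⁻¹) (orthoTube L 1 v)) 1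
      ∂haarProbability SU2 := ⟨_, rfl⟩
  obtain ⟨Y₃, hY₃⟩ : ∃ Y₃ : (Edge 3 L → Fin 3 → ℝ) → ℝ, Y₃ = fun v => ∫ c, fpFibreTransfer L β (fun x => Ω x * (‖x‖ ^ 2) ^ 4) W (gaugeTransform (fun _ : Site 3 L => c⁻¹) (orthoTube L 1 v)) 1 ∂haarProbability SU2 :=
    ⟨_, rfl⟩
  obtain ⟨Y₄, hY₄⟩ : ∃ Y₄ : (Edge 3 L → Fin 3 → ℝ) → ℝ, Y₄ = fun v => ∫ c, fpFibreTransfer L β Ω (fun g => W g * (∑ x, ‖su2Quat (g x) - 1‖ ^ 2) ^ 4) (gaugeTransform (fun _ : Site 3 L => c⁻¹) (orthoTube L 1 v)) 1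
      ∂haarProbability SU2 := ⟨_, rfl⟩
  obtain ⟨Ef, hEf⟩ : ∃ Ef : (Edge 3 L → Fin 3 → ℝ) → ℝ, Ef = fun v => cq * (a₀' * Real.exp (-(q β (linkEmbed L v)))) := ⟨_, rfl⟩
  obtain ⟨Φ, hΦ⟩ : ∃ Φ : GaugeConfig 3 1 SU2 → (Edge 3 L → Fin 3 → ℝ) → ℝ, Φ = fun u v =>
      Af u * (40 * (1 + ηc) * (G₀f u v * Y₀ v + G₁f u * (Y₁ v + Y₂ v) + 9 * c₂ ^ 2 * Rf u * (Y₃ v + Y₄ v)) + 2 * ηc ^ 2 * Ef v * Rf u) := ⟨_, rfl⟩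
  obtain ⟨Kf, hKf⟩ : ∃ Kf : GaugeConfig 3 L SU2 → ℝ, Kf = fun U =>
      Zi * ∫ w, φ w * (∫ c, fpFibreTransfer L β Ω W (gaugeTransform (fun _ : Site 3 L => c⁻¹) U) w ∂haarProbability SU2) ∂configMeasure SU2 1 := ⟨_, rfl⟩
  obtain ⟨Ps, hPs⟩ : ∃ Ps : GaugeConfig 3 1 SU2 → ℝ, Ps = fun u => ∫ w, φ w * (avgKernel B u w / K1) ∂configMeasure SU2 1 := ⟨_, rfl⟩
  obtain ⟨Pa, hPa⟩ : ∃ Pa : GaugeConfig 3 1 SU2 → ℝ, Pa = fun u => ∫ w, |φ w| * (avgKernel B u w / K1) ∂configMeasure SU2 1 := ⟨_, rfl⟩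
  have hodm : Measurable (orbitDist (L := 1)) := measurable_orbitDist
  have hKm : Measurable Kf := by
    rw [hKf]
    have hH : Measurable fun z : GaugeConfig 3 L SU2 × GaugeConfig 3 1 SU2 =>
        φ z.2 * ∫ c, fpFibreTransfer L β Ω W (gaugeTransform (fun _ : Site 3 L => c⁻¹) z.1) z.2 ∂haarProbability SU2 :=
      (hφm.comp measurable_snd).mul (measurable_colour_fpFibreTransfer_uncurry (L := L) β hΩm hW)
    exact (hH.stronglyMeasurable.integral_prod_right' (ν := configMeasure SU2 1)).measurable.const_mul Zi
  have hPsm : Measurable Ps := by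
    rw [hPs, hK1]; exact measurable_integral_mul_avgRatio B measurable_id (hφm.comp measurable_snd)
  have hPam : Measurable Pa := by
    rw [hPa, hK1]; exact measurable_integral_mul_avgRatio B measurable_id ((hφm.comp measurable_snd).abs)
  have hAfm : Measurable Af := by
    rw [hAf, hK1]; exact measurable_integral_mul_avgRatio B measurable_id ((hφm.comp measurable_snd).pow_const 2)
  have hRfm : Measurable Rf := by
    rw [hRf, hK1]
    have h := measurable_integral_mul_avgRatio B (Y := GaugeConfig 3 1 SU2) measurable_id (H := fun _ => (1 : ℝ)) measurable_const
    simpa only [one_mul, id] using h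
  have hc₁m : Measurable (Function.uncurry c₁f) := by
    rw [hc₁f]
    exact measurable_const.mul ((measurable_const.mul (measurable_const.mul ((hodm.comp measurable_fst).add (hodm.comp measurable_snd)))).add measurable_const)
  have hc₀m : Measurable (Function.uncurry c₀f) := by
    rw [hc₀f]
    exact ((measurable_const.mul ((hodm.comp measurable_fst).add (hodm.comp measurable_snd))).mul (hodm.comp measurable_fst)).mul measurable_const
  have hG₁m : Measurable G₁f := by
    rw [hG₁f, hK1]
    have h := measurable_integral_mul_avgRatio B (Y := GaugeConfig 3 1 SU2) measurable_id (H := fun z => c₁f z.1 z.2 ^ 2) (hc₁m.pow_const 2)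
    simpa only [id] using h
  have hsm : Measurable fun v : Edge 3 L → Fin 3 → ℝ => min (‖linkEmbed L v‖ ^ 2) (Rin ^ 2) := ((measurable_linkEmbed L).norm.pow_const 2).min measurable_const
  have hG₀m : Measurable (Function.uncurry G₀f) := by
    rw [hG₀f, hK1]
    have hH : Measurable fun z : (GaugeConfig 3 1 SU2 × (Edge 3 L → Fin 3 → ℝ)) × GaugeConfig 3 1 SU2 =>
        (c₀f z.1.1 z.2 + c₁f z.1.1 z.2 * min (‖linkEmbed L z.1.2‖ ^ 2) (Rin ^ 2) + 3 * c₂ * (min (‖linkEmbed L z.1.2‖ ^ 2) (Rin ^ 2)) ^ 2) ^ 2 := by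
      have h0 : Measurable fun z : (GaugeConfig 3 1 SU2 × (Edge 3 L → Fin 3 → ℝ)) × GaugeConfig 3 1 SU2 => c₀f z.1.1 z.2 :=
        hc₀m.comp ((measurable_fst.comp measurable_fst).prodMk measurable_snd)
      have h1 : Measurable fun z : (GaugeConfig 3 1 SU2 × (Edge 3 L → Fin 3 → ℝ)) × GaugeConfig 3 1 SU2 => c₁f z.1.1 z.2 :=
        hc₁m.comp ((measurable_fst.comp measurable_fst).prodMk measurable_snd)
      have hs : Measurable fun z : (GaugeConfig 3 1 SU2 × (Edge 3 L → Fin 3 → ℝ)) × GaugeConfig 3 1 SU2 => min (‖linkEmbed L z.1.2‖ ^ 2) (Rin ^ 2) :=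
        hsm.comp (measurable_snd.comp measurable_fst)
      exact ((h0.add (h1.mul hs)).add (measurable_const.mul (hs.pow_const 2))).pow_const 2
    exact measurable_integral_mul_avgRatio B (Y := GaugeConfig 3 1 SU2 × (Edge 3 L → Fin 3 → ℝ)) measurable_fst hH
  have hΩkm : ∀ k : ℕ, Measurable fun x : LinkSpace L => Ω x * (‖x‖ ^ 2) ^ k := fun k => hΩm.mul ((measurable_norm.pow_const 2).pow_const k)
  have hWjm : ∀ j : ℕ, Measurable fun g : Site 3 L → SU2 => W g * (∑ x, ‖su2Quat (g x) - 1‖ ^ 2) ^ j := fun j => hW.mul (measurable_gaugeDevSq.pow_const j)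
  have hY₀m : Measurable Y₀ := by rw [hY₀]; exact measurable_colour_central_transfer β hΩm hW
  have hY₁m : Measurable Y₁ := by rw [hY₁]; exact measurable_colour_central_transfer β (hΩkm 2) hW
  have hY₂m : Measurable Y₂ := by rw [hY₂]; exact measurable_colour_central_transfer β hΩm (hWjm 2)
  have hY₃m : Measurable Y₃ := by rw [hY₃]; exact measurable_colour_central_transfer β (hΩkm 4) hW
  have hY₄m : Measurable Y₄ := by rw [hY₄]; exact measurable_colour_central_transfer β hΩm (hWjm 4)
  have hEfm : Measurable Ef := by
    rw [hEf]; exact measurable_const.mul (measurable_const.mul (((hqm β).comp (measurable_linkEmbed L)).neg.exp))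
  have hΦm : Measurable (Function.uncurry Φ) := by
    rw [hΦ]
    have hA : Measurable fun p : GaugeConfig 3 1 SU2 × (Edge 3 L → Fin 3 → ℝ) => Af p.1 := hAfm.comp measurable_fst
    have hR : Measurable fun p : GaugeConfig 3 1 SU2 × (Edge 3 L → Fin 3 → ℝ) => Rf p.1 := hRfm.comp measurable_fst
    have hG1 : Measurable fun p : GaugeConfig 3 1 SU2 × (Edge 3 L → Fin 3 → ℝ) => G₁f p.1 := hG₁m.comp measurable_fst
    have hG0 : Measurable fun p : GaugeConfig 3 1 SU2 × (Edge 3 L → Fin 3 → ℝ) => G₀f p.1 p.2 := hG₀m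
    have hy0 : Measurable fun p : GaugeConfig 3 1 SU2 × (Edge 3 L → Fin 3 → ℝ) => Y₀ p.2 := hY₀m.comp measurable_snd
    have hy1 : Measurable fun p : GaugeConfig 3 1 SU2 × (Edge 3 L → Fin 3 → ℝ) => Y₁ p.2 := hY₁m.comp measurable_snd
    have hy2 : Measurable fun p : GaugeConfig 3 1 SU2 × (Edge 3 L → Fin 3 → ℝ) => Y₂ p.2 := hY₂m.comp measurable_snd
    have hy3 : Measurable fun p : GaugeConfig 3 1 SU2 × (Edge 3 L → Fin 3 → ℝ) => Y₃ p.2 := hY₃m.comp measurable_snd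
    have hy4 : Measurable fun p : GaugeConfig 3 1 SU2 × (Edge 3 L → Fin 3 → ℝ) => Y₄ p.2 := hY₄m.comp measurable_snd
    have he : Measurable fun p : GaugeConfig 3 1 SU2 × (Edge 3 L → Fin 3 → ℝ) => Ef p.2 := hEfm.comp measurable_snd
    exact hA.mul ((measurable_const.mul (((hG0.mul hy0).add (hG1.mul (hy1.add hy2))).add
      ((measurable_const.mul hR).mul (hy3.add hy4)))).add ((measurable_const.mul he).mul hR))
  have hCφ0 : 0 ≤ Cφ := (abs_nonneg _).trans (hφb 1)
  have hφ2 : ∀ w, φ w ^ 2 ≤ Cφ ^ 2 := fun w => by rw [← sq_abs]; exact pow_le_pow_left₀ (abs_nonneg _) (hφb w) 2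
  have hAf0 : ∀ u, 0 ≤ Af u := fun u => by rw [hAf]; exact integral_nonneg fun w => mul_nonneg (sq_nonneg _) (hρ0 u w)
  have hAfb : ∀ u, Af u ≤ Cφ ^ 2 * (M / K1) := fun u => by rw [hAf, hK1]; exact integral_mul_avgRatio_le hM (fun w => sq_nonneg _) hφ2 u
  have hRf0 : ∀ u, 0 ≤ Rf u := fun u => by rw [hRf]; exact integral_nonneg fun w => hρ0 u w
  have hRfb : ∀ u, Rf u ≤ 1 * (M / K1) := fun u => by
    rw [hRf, hK1]; have h := integral_mul_avgRatio_le hM (h := fun _ => (1 : ℝ)) (fun _ => zero_le_one) (fun _ => le_rfl) u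
    simpa only [one_mul] using h
  have hc₀0 : ∀ u w, 0 ≤ c₀f u w := fun u w => hc₀f ▸ mul_nonneg (mul_nonneg (mul_nonneg (mul_nonneg (by norm_num) hβ) (add_nonneg (hod0 u).1 (hod0 w).1)) (hod0 u).1) hΓ
  have hc₁0 : ∀ u w, 0 ≤ c₁f u w := fun u w => by
    rw [hc₁f]; exact mul_nonneg hKL0 (add_nonneg (mul_nonneg hβ (mul_nonneg hAL0 (add_nonneg (hod0 u).1 (hod0 w).1))) (div_nonneg (Real.sqrt_nonneg _) two_pos.le))
  obtain ⟨C0m, hC0m⟩ : ∃ C0m : ℝ, C0m = 216 * β * (4 * (Fintype.card (Edge 3 1) : ℝ) + 4 * (Fintype.card (Edge 3 1) : ℝ)) * (4 * (Fintype.card (Edge 3 1) : ℝ)) * Γ := ⟨_, rfl⟩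
  obtain ⟨C1m, hC1m⟩ : ∃ C1m : ℝ, C1m = KL * (β * (AL * (4 * (Fintype.card (Edge 3 1) : ℝ) + 4 * (Fintype.card (Edge 3 1) : ℝ))) + Real.sqrt β / 2) := ⟨_, rfl⟩
  have hc₀b : ∀ u w, c₀f u w ≤ C0m := fun u w => by
    rw [hc₀f, hC0m]
    have h216 : (0 : ℝ) ≤ 216 * β := mul_nonneg (by norm_num) hβ
    have h1 : orbitDist u + orbitDist w ≤ 4 * (Fintype.card (Edge 3 1) : ℝ) + 4 * (Fintype.card (Edge 3 1) : ℝ) := add_le_add (hod0 u).2 (hod0 w).2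
    have h2 := mul_le_mul_of_nonneg_left h1 h216
    have h3 : 216 * β * (orbitDist u + orbitDist w) * orbitDist u ≤ 216 * β * (4 * (Fintype.card (Edge 3 1) : ℝ) + 4 * (Fintype.card (Edge 3 1) : ℝ)) * (4 * (Fintype.card (Edge 3 1) : ℝ)) :=
      mul_le_mul h2 (hod0 u).2 (hod0 u).1 (mul_nonneg h216 (add_nonneg hE0 hE0))
    exact mul_le_mul_of_nonneg_right h3 hΓ
  have hc₁b : ∀ u w, c₁f u w ≤ C1m := fun u w => by
    rw [hc₁f, hC1m]
    have h1 : orbitDist u + orbitDist w ≤ 4 * (Fintype.card (Edge 3 1) : ℝ) + 4 * (Fintype.card (Edge 3 1) : ℝ) := add_le_add (hod0 u).2 (hod0 w).2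
    exact mul_le_mul_of_nonneg_left (add_le_add (mul_le_mul_of_nonneg_left (mul_le_mul_of_nonneg_left h1 hAL0) hβ) le_rfl) hKL0
  have hC1m0 : 0 ≤ C1m := (hc₁0 1 1).trans (hc₁b 1 1)
  have hs0 : ∀ v : Edge 3 L → Fin 3 → ℝ, 0 ≤ min (‖linkEmbed L v‖ ^ 2) (Rin ^ 2) ∧ min (‖linkEmbed L v‖ ^ 2) (Rin ^ 2) ≤ Rin ^ 2 := fun v =>
    ⟨le_min (sq_nonneg _) (sq_nonneg _), min_le_right _ _⟩
  obtain ⟨Cg0, hCg0⟩ : ∃ Cg0 : ℝ, Cg0 = (C0m + C1m * Rin ^ 2 + 3 * c₂ * (Rin ^ 2) ^ 2) ^ 2 := ⟨_, rfl⟩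
  have hg₀b : ∀ u w (v : Edge 3 L → Fin 3 → ℝ), (c₀f u w + c₁f u w * min (‖linkEmbed L v‖ ^ 2) (Rin ^ 2) + 3 * c₂ * (min (‖linkEmbed L v‖ ^ 2) (Rin ^ 2)) ^ 2) ^ 2 ≤ Cg0 :=
      fun u w v => by
    rw [hCg0]
    have ha : 0 ≤ c₀f u w + c₁f u w * min (‖linkEmbed L v‖ ^ 2) (Rin ^ 2) + 3 * c₂ * (min (‖linkEmbed L v‖ ^ 2) (Rin ^ 2)) ^ 2 :=
      add_nonneg (add_nonneg (hc₀0 u w) (mul_nonneg (hc₁0 u w) (hs0 v).1)) (mul_nonneg (mul_nonneg (by norm_num) hc₂0) (sq_nonneg _))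
    have hb : c₀f u w + c₁f u w * min (‖linkEmbed L v‖ ^ 2) (Rin ^ 2) + 3 * c₂ * (min (‖linkEmbed L v‖ ^ 2) (Rin ^ 2)) ^ 2 ≤ C0m + C1m * Rin ^ 2 + 3 * c₂ * (Rin ^ 2) ^ 2 :=
      add_le_add (add_le_add (hc₀b u w) (mul_le_mul (hc₁b u w) (hs0 v).2 (hs0 v).1 hC1m0))
        (mul_le_mul_of_nonneg_left (pow_le_pow_left₀ (hs0 v).1 (hs0 v).2 2) (mul_nonneg (by norm_num) hc₂0))
    exact pow_le_pow_left₀ ha hb 2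
  have hG₀0 : ∀ u v, 0 ≤ G₀f u v := fun u v => by rw [hG₀f]; exact integral_nonneg fun w => mul_nonneg (sq_nonneg _) (hρ0 u w)
  have hG₀b : ∀ u v, G₀f u v ≤ Cg0 * (M / K1) := fun u v => by rw [hG₀f, hK1]; exact integral_mul_avgRatio_le hM (fun w => sq_nonneg _) (fun w => hg₀b u w v) u
  have hG₁0 : ∀ u, 0 ≤ G₁f u := fun u => by rw [hG₁f]; exact integral_nonneg fun w => mul_nonneg (sq_nonneg _) (hρ0 u w)
  have hG₁b : ∀ u, G₁f u ≤ C1m ^ 2 * (M / K1) := fun u => by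
    rw [hG₁f, hK1]; exact integral_mul_avgRatio_le hM (fun w => sq_nonneg _) (fun w => pow_le_pow_left₀ (hc₁0 u w) (hc₁b u w) 2) u
  -- bounds for the colour-averaged central transfers
  have hΩR : ∀ x : LinkSpace L, Ω x ≠ 0 → ‖x‖ ≤ R := fun x hx => by
    have h := (hΩt (linkCurry x) (by rwa [linkEmbed_linkCurry])).2
    rwa [linkEmbed_linkCurry] at h
  have hΩk0 : ∀ (k : ℕ) (x : LinkSpace L), 0 ≤ Ω x * (‖x‖ ^ 2) ^ k := fun k x => mul_nonneg (hΩ0 x) (by positivity)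
  have hΩkb : ∀ (k : ℕ) (x : LinkSpace L), |Ω x * (‖x‖ ^ 2) ^ k| ≤ CΩ * (R ^ 2) ^ k := fun k x => by
    have hCΩ0 : 0 ≤ CΩ := (abs_nonneg _).trans (hCΩ 0)
    by_cases hx : Ω x = 0
    · rw [hx, zero_mul, abs_zero]; positivity
    · rw [abs_mul, abs_of_nonneg (by positivity : (0 : ℝ) ≤ (‖x‖ ^ 2) ^ k)]
      exact mul_le_mul (hCΩ x) (pow_le_pow_left₀ (sq_nonneg _) (pow_le_pow_left₀ (norm_nonneg _) (hΩR x hx) 2) k) (by positivity) hCΩ0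
  have hWj0 : ∀ (j : ℕ) (g : Site 3 L → SU2), 0 ≤ W g * (∑ x, ‖su2Quat (g x) - 1‖ ^ 2) ^ j := fun j g => mul_nonneg (hW0 g) (pow_nonneg (gaugeDevSq_mem g).1 j)
  have hWjb : ∀ (j : ℕ) (g : Site 3 L → SU2), |W g * (∑ x, ‖su2Quat (g x) - 1‖ ^ 2) ^ j| ≤ CW * (4 * Fintype.card (Site 3 L)) ^ j := fun j g => by
    have hCW0 : 0 ≤ CW := (abs_nonneg _).trans (hCW 1)
    rw [abs_mul, abs_of_nonneg (pow_nonneg (gaugeDevSq_mem g).1 j)]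
    exact mul_le_mul (hCW g) (pow_le_pow_left₀ (gaugeDevSq_mem g).1 (gaugeDevSq_mem g).2 j) (pow_nonneg (gaugeDevSq_mem g).1 j) hCW0
  obtain ⟨B₀, hB₀⟩ := abs_fpFibreTransfer_le' (L := L) β hCΩ hCW
  obtain ⟨B₁, hB₁⟩ := abs_fpFibreTransfer_le' (L := L) β (hΩkb 2) hCW
  obtain ⟨B₂, hB₂⟩ := abs_fpFibreTransfer_le' (L := L) β hCΩ (hWjb 2)
  obtain ⟨B₃, hB₃⟩ := abs_fpFibreTransfer_le' (L := L) β (hΩkb 4) hCW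
  obtain ⟨B₄, hB₄⟩ := abs_fpFibreTransfer_le' (L := L) β hCΩ (hWjb 4)
  have hYb : ∀ {Ωm : LinkSpace L → ℝ} {Wm : (Site 3 L → SU2) → ℝ} {Bm : ℝ}, (∀ x, 0 ≤ Ωm x) → (∀ g, 0 ≤ Wm g) →
      (∀ (U : GaugeConfig 3 L SU2) (u : GaugeConfig 3 1 SU2), |fpFibreTransfer L β Ωm Wm U u| ≤ Bm) → ∀ v : Edge 3 L → Fin 3 → ℝ,
      0 ≤ ∫ c, fpFibreTransfer L β Ωm Wm (gaugeTransform (fun _ : Site 3 L => c⁻¹) (orthoTube L 1 v)) 1 ∂haarProbability SU2 ∧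
        ∫ c, fpFibreTransfer L β Ωm Wm (gaugeTransform (fun _ : Site 3 L => c⁻¹) (orthoTube L 1 v)) 1 ∂haarProbability SU2 ≤ |Bm| := by
    intro Ωm Wm Bm hΩm0 hWm0 hBm v
    refine ⟨integral_nonneg fun c => fpFibreTransfer_nonneg β hΩm0 hWm0 _ _, ?_⟩
    calc ∫ c, fpFibreTransfer L β Ωm Wm (gaugeTransform (fun _ : Site 3 L => c⁻¹) (orthoTube L 1 v)) 1 ∂haarProbability SU2
        ≤ ∫ _c, |Bm| ∂haarProbability SU2 :=
          integral_mono_of_nonneg (ae_of_all _ fun c => fpFibreTransfer_nonneg β hΩm0 hWm0 _ _) (integrable_const _)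
            (ae_of_all _ fun c => (le_abs_self _).trans ((hBm _ _).trans (le_abs_self _)))
      _ = |Bm| := by rw [integral_const, smul_eq_mul, probReal_univ, one_mul]
  have hY₀b : ∀ v, 0 ≤ Y₀ v ∧ Y₀ v ≤ |B₀| := fun v => by rw [hY₀]; exact hYb hΩ0 hW0 hB₀ v
  have hY₁b : ∀ v, 0 ≤ Y₁ v ∧ Y₁ v ≤ |B₁| := fun v => by rw [hY₁]; exact hYb (hΩk0 2) hW0 hB₁ v
  have hY₂b : ∀ v, 0 ≤ Y₂ v ∧ Y₂ v ≤ |B₂| := fun v => by rw [hY₂]; exact hYb hΩ0 (hWj0 2) hB₂ v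
  have hY₃b : ∀ v, 0 ≤ Y₃ v ∧ Y₃ v ≤ |B₃| := fun v => by rw [hY₃]; exact hYb (hΩk0 4) hW0 hB₃ v
  have hY₄b : ∀ v, 0 ≤ Y₄ v ∧ Y₄ v ≤ |B₄| := fun v => by rw [hY₄]; exact hYb hΩ0 (hWj0 4) hB₄ v
  have hEf0 : ∀ v, 0 ≤ Ef v := fun v => by rw [hEf]; exact mul_nonneg hcq (mul_nonneg ha₀' (Real.exp_nonneg _))
  have hEfb : ∀ v, Ef v ≤ cq * a₀' := fun v => by
    rw [hEf]
    have h1 : Real.exp (-(q β (linkEmbed L v))) ≤ 1 := Real.exp_le_one_iff.mpr (by linarith [hq0 (linkEmbed L v)])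
    have h2 : a₀' * Real.exp (-(q β (linkEmbed L v))) ≤ a₀' := by nlinarith
    exact mul_le_mul_of_nonneg_left h2 hcq
  obtain ⟨hηA, hηE, h9⟩ : (0 : ℝ) ≤ 40 * (1 + ηc) ∧ (0 : ℝ) ≤ 2 * ηc ^ 2 ∧ (0 : ℝ) ≤ 9 * c₂ ^ 2 :=
    ⟨mul_nonneg (by norm_num) (by linarith), mul_nonneg two_pos.le (sq_nonneg _), mul_nonneg (by norm_num) (sq_nonneg _)⟩
  obtain ⟨CΦ, hCΦ⟩ : ∃ CΦ : ℝ, CΦ = Cφ ^ 2 * (M / K1) *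
      (40 * (1 + ηc) * (Cg0 * (M / K1) * |B₀| + C1m ^ 2 * (M / K1) * (|B₁| + |B₂|) + 9 * c₂ ^ 2 * (1 * (M / K1)) * (|B₃| + |B₄|)) +
        2 * ηc ^ 2 * (cq * a₀') * (1 * (M / K1))) := ⟨_, rfl⟩
  have hΦ0 : ∀ u v, 0 ≤ Φ u v := fun u v => by
    rw [hΦ]
    exact mul_nonneg (hAf0 u) (add_nonneg (mul_nonneg hηA (add_nonneg (add_nonneg (mul_nonneg (hG₀0 u v) (hY₀b v).1)
      (mul_nonneg (hG₁0 u) (add_nonneg (hY₁b v).1 (hY₂b v).1))) (mul_nonneg (mul_nonneg h9 (hRf0 u)) (add_nonneg (hY₃b v).1 (hY₄b v).1))))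
      (mul_nonneg (mul_nonneg hηE (hEf0 v)) (hRf0 u)))
  have hΦb : ∀ u v, Φ u v ≤ CΦ := fun u v => by
    rw [hΦ, hCΦ]
    have hX0 : 0 ≤ G₀f u v * Y₀ v + G₁f u * (Y₁ v + Y₂ v) + 9 * c₂ ^ 2 * Rf u * (Y₃ v + Y₄ v) :=
      add_nonneg (add_nonneg (mul_nonneg (hG₀0 u v) (hY₀b v).1) (mul_nonneg (hG₁0 u) (add_nonneg (hY₁b v).1 (hY₂b v).1)))
        (mul_nonneg (mul_nonneg h9 (hRf0 u)) (add_nonneg (hY₃b v).1 (hY₄b v).1))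
    have hX : G₀f u v * Y₀ v + G₁f u * (Y₁ v + Y₂ v) + 9 * c₂ ^ 2 * Rf u * (Y₃ v + Y₄ v) ≤
        Cg0 * (M / K1) * |B₀| + C1m ^ 2 * (M / K1) * (|B₁| + |B₂|) + 9 * c₂ ^ 2 * (1 * (M / K1)) * (|B₃| + |B₄|) :=
      add_le_add (add_le_add (mul_le_mul (hG₀b u v) (hY₀b v).2 (hY₀b v).1 (mul_nonneg (by rw [hCg0]; exact sq_nonneg _) hMK))
        (mul_le_mul (hG₁b u) (add_le_add (hY₁b v).2 (hY₂b v).2) (add_nonneg (hY₁b v).1 (hY₂b v).1) ((hG₁0 u).trans (hG₁b u))))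
        (mul_le_mul (mul_le_mul_of_nonneg_left (hRfb u) h9) (add_le_add (hY₃b v).2 (hY₄b v).2) (add_nonneg (hY₃b v).1 (hY₄b v).1)
          (mul_nonneg h9 ((hRf0 u).trans (hRfb u))))
    have hin0 : 0 ≤ 40 * (1 + ηc) * (G₀f u v * Y₀ v + G₁f u * (Y₁ v + Y₂ v) + 9 * c₂ ^ 2 * Rf u * (Y₃ v + Y₄ v)) + 2 * ηc ^ 2 * Ef v * Rf u :=
      add_nonneg (mul_nonneg hηA hX0) (mul_nonneg (mul_nonneg hηE (hEf0 v)) (hRf0 u))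
    have hin : 40 * (1 + ηc) * (G₀f u v * Y₀ v + G₁f u * (Y₁ v + Y₂ v) + 9 * c₂ ^ 2 * Rf u * (Y₃ v + Y₄ v)) + 2 * ηc ^ 2 * Ef v * Rf u ≤
        40 * (1 + ηc) * (Cg0 * (M / K1) * |B₀| + C1m ^ 2 * (M / K1) * (|B₁| + |B₂|) + 9 * c₂ ^ 2 * (1 * (M / K1)) * (|B₃| + |B₄|)) +
          2 * ηc ^ 2 * (cq * a₀') * (1 * (M / K1)) :=
      add_le_add (mul_le_mul_of_nonneg_left hX hηA)
        (mul_le_mul (mul_le_mul_of_nonneg_left (hEfb v) hηE) (hRfb u) (hRf0 u) (mul_nonneg hηE (mul_nonneg hcq ha₀')))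
    exact mul_le_mul (hAfb u) hin hin0 (mul_nonneg (sq_nonneg _) hMK)
  have hPab : ∀ u, |Pa u| ≤ Cφ * (M / K1) := fun u => by
    have h0 : 0 ≤ Pa u := by rw [hPa]; exact integral_nonneg fun w => mul_nonneg (abs_nonneg _) (hρ0 u w)
    rw [abs_of_nonneg h0, hPa, hK1]; exact integral_mul_avgRatio_le hM (fun w => abs_nonneg _) hφb u
  have hPPa : ∀ u, |Ps u| ≤ Pa u := fun u => by
    rw [hPs, hPa]
    refine (abs_integral_le_integral_abs).trans (le_of_eq (integral_congr_ae (ae_of_all _ fun w => ?_)))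
    show |φ w * (avgKernel B u w / K1)| = |φ w| * (avgKernel B u w / K1)
    rw [abs_mul, abs_of_nonneg (hρ0 u w)]
  -- the pointwise `hdef` from the windowed Cauchy–Schwarz defect (`W_out = {orbitDist ≤ d_O}` is measurable: `measurableSet_le`)
  have hdef : ∀ u' ∈ {u : GaugeConfig 3 1 SU2 | orbitDist u ≤ dO}, ∀ v' ∈ capBalancedSet L, ‖linkEmbed L v'‖ ≤ Rin → orthoTube L u' v' ∈ F →
      (Kf (orthoTube L u' v') - Zi * (cq * a₀' * Real.exp (-(q β (linkEmbed L v')))) * Ps u') ^ 2 ≤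
        Zi ^ 2 * (cq * a₀' * Real.exp (-(q β (linkEmbed L v')))) * Φ u' v' := by
    intro u' hu' v' hv' hx' _
    have hu'd : orbitDist u' ≤ dO := hu'
    have hsx : min (‖linkEmbed L v'‖ ^ 2) (Rin ^ 2) = ‖linkEmbed L v'‖ ^ 2 :=
      min_eq_left (pow_le_pow_left₀ (norm_nonneg _) hx' 2)
    have hWM := colour_defect_sq_slow_le_orbit_moments (L := L) hβ1 hΩm hCΩ hΩ0 hW hCW hW0 hdO hdI hd1 hσ hRinT hΓ hΩt hWc
      (P := fun x => a₀' * Real.exp (-(q β x))) (fun g x => by show a₀' * Real.exp (-(q β (adL L g x))) = a₀' * Real.exp (-(q β x)); rw [hqinv]) hcq (fun x => mul_nonneg ha₀' (Real.exp_nonneg _)) hηc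
      (fun v'' h1 h2 h3 => by simpa only using hC1 v'' h1 h2 h3) hS900 hc₂ hH1 u' hu'd hv' hx' hφm hφb hφs
    beta_reduce at hWM
    rw [hKf, hPs, hΦ, hAf, hRf, hG₀f, hG₁f, hc₀f, hc₁f, hY₀, hY₁, hY₂, hY₃, hY₄, hEf]
    beta_reduce
    rw [hsx, hKL, hAL, hK1, hB]
    exact sq_core_rescale hWM
  -- the composition
  have main := defect_core_sq_integral_le_moment (L := L) β hF hχ hNκ hκ hPχ hqm hq0 r hKm hPsm hPam hPab hPPa hΦm hΦ0 hΦb hZi (mul_nonneg hcq ha₀') hRin (measurableSet_le hodm measurable_const) hdef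
  rw [hKf, hPs, hPa, hΦ, hAf, hRf, hG₀f, hG₁f, hc₀f, hc₁f, hY₀, hY₁, hY₂, hY₃, hY₄, hEf] at main
  beta_reduce at main
  rw [hKL, hAL, hK1, hB] at main
  exact main

end Summit.QuantumFields.YangMills.Theorems.FemtoTransferGap.TwoLattice.ConstTube

end
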